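import Literature.MathematicalPhysics.QuantumLattice.SiteBijectionSectorTransport
import Literature.MathematicalPhysics.QuantumLattice.HubbardHalfFilledGroundState
import HarnessLib

/-!
# Spin-flip symmetry of the Hubbard sectors: `λ_min(N, S^z = -M) = λ_min(N, S^z = M)`

Family `hubbard` (trunk T-QLATTICE); companion of `HubbardHalfFilledGroundState` for the
certified-numerics cell `pub-mbboot`.

The spin exchange `(x, σ) ↦ (x, 1 - σ)` of the orbitals (`Orb.spinSwap`) is implemented on Fock
space by the signed permutation `relabelVec Orb.spinSwap` (`Γ`), with `Γ A Γ⁻¹ = relabel Orb.spinSwap A`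
(`FermionRelabelling`, `ProjectedBCSStateReal`). It reverses `S^z` (`relabel_spinSwap_spinZ`:
`Γ S^z Γ⁻¹ = -S^z`), hence maps the joint sector `(N, S^z = M)` onto `(N, S^z = -M)`
(`mem_szSector_neg_relabelVec_spinSwap`), and it commutes with the Hubbard Hamiltonian
(`relabel_spinSwap_hamiltonian`, from the tree's `relabel_spinSwap_hamiltonianWith`). Consequently
the sector energies are even in `S^z`:

* `minEnergyOn_szSector_neg` — for any spin-swap-invariant `H`,
  `H.minEnergyOn (szSector N (-M)) = H.minEnergyOn (szSector N M)`;
  `hubbard_minEnergyOn_szSector_neg` — the Hubbard case;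
* `re_rayleigh_ge_szSector_neg` — form bounds transfer between the two sectors;
* `SpinGapCertificate.groundSector_le_szSector_of_form_bound`,
  `SpinGapCertificate.groundState_certificate_of_form_bound` — the spin-gap route to THE
  `2n`-particle ground state of `HubbardHalfFilledGroundState` needs a certified form bound on the
  `S^z = +1` sector ONLY (the `S^z = -1` bound follows by symmetry).

## References

* E. H. Lieb, *Two theorems on the Hubbard model*, Phys. Rev. Lett. 62 (1989) 1201, proof of
  Theorem 1 ("the Hamiltonian is symmetric between the up and the down spins"). [LiebPRL1989]
* G. Benfatto, A. Giuliani, V. Mastropietro, Ann. Henri Poincaré 7 (2006) 809, §2.1, symmetry (1)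
  (spin exchange). [BenfattoGiulianiMastropietro2006]
* O. Bratteli, D. W. Robinson, *Operator Algebras and Quantum Statistical Mechanics II* (1997),
  §5.2.2, Thm. 5.2.5 (Bogoliubov transformations are unitarily implemented).
  [BratteliRobinsonII1997]
-/

noncomputable section

namespace Literature.MathematicalPhysics.QuantumLattice

open Matrix Finset
open scoped ComplexOrder

section SpinFlip

variable {Λ : Type*} [LinearOrder Λ] [Fintype Λ]

-- The next two statements and `relabel_spinSwap_hamiltonian` below also exist Summits-side
-- (Summits/HubbardSuperconductivity/HubbardSuperconductivity/Theorems/NodalDiracTwistRealCyclicOverlap.lean,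
--  …/CooperPairDMottWalkCooperPairDMottPlaquetteOddSectorFloor.lean, route-local namespaces);
-- Literature cannot import Summits, so they are re-homed here (same statements, one-line proofs
-- from `FermionRelabelling`), as `LiebTwoHoppings.fermionTorusGraph_connected` was.
/-- `Γ n_{xσ} Γ⁻¹ = n_{x,1-σ}` for the spin exchange (re-homed from a Summits-side theorem file,
see the comment above). [folklore] -/
theorem relabel_spinSwap_numberOp (x : Λ) (σ : Fin 2) :
    relabel (Orb.spinSwap : Orb Λ ≃ Orb Λ) (numberOp x σ) =
      numberOp x (Equiv.swap (0 : Fin 2) 1 σ) := by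
  rw [numberOp, numberOp, map_mul, relabel_creation, relabel_annihilation, Orb.spinSwap_orb]

/-- **Spin exchange reverses `S^z`**: `Γ S^z Γ⁻¹ = -S^z` (re-homed from a Summits-side theorem
file, see above). [cite: LiebPRL1989, proof of Theorem 1] -/
theorem relabel_spinSwap_spinZ :
    relabel (Orb.spinSwap : Orb Λ ≃ Orb Λ)
        (HubbardWave0.spinZ : Matrix (Finset (Orb Λ)) (Finset (Orb Λ)) ℂ) = -HubbardWave0.spinZ := by
  rw [HubbardWave0.spinZ, map_smul, map_sum, ← smul_neg, ← Finset.sum_neg_distrib]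
  congr 1
  refine Finset.sum_congr rfl fun x _ => ?_
  rw [map_sub, relabel_spinSwap_numberOp, relabel_spinSwap_numberOp, Equiv.swap_apply_left,
    Equiv.swap_apply_right, neg_sub]

/-- `Γ` maps the joint sector `(N, S^z = M)` into `(N, S^z = -M)`. [folklore] -/
theorem mem_szSector_neg_relabelVec_spinSwap {N : ℕ} {M : ℝ} {ψ : Fock (Orb Λ)}
    (hψ : ψ ∈ szSector N M) :
    relabelVec (Orb.spinSwap : Orb Λ ≃ Orb Λ) ψ ∈ szSector N (-M) := by
  rw [mem_szSector_iff] at hψ ⊢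
  refine ⟨isNParticle_relabelVec _ hψ.1, ?_⟩
  have h := congrArg (relabelVec (Orb.spinSwap : Orb Λ ≃ Orb Λ)) hψ.2
  rw [← relabel_mulVec_relabelVec, relabel_spinSwap_spinZ, relabelVec_smul, neg_mulVec,
    neg_eq_iff_eq_neg, ← neg_smul] at h
  rw [h, Complex.ofReal_neg]

/-- Conversely, `Γ` maps `(N, S^z = -M)` into `(N, S^z = M)`. [folklore] -/
theorem mem_szSector_relabelVec_spinSwap_of_neg {N : ℕ} {M : ℝ} {ψ : Fock (Orb Λ)}
    (hψ : ψ ∈ szSector N (-M)) :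
    relabelVec (Orb.spinSwap : Orb Λ ≃ Orb Λ) ψ ∈ szSector N M := by
  have h := mem_szSector_neg_relabelVec_spinSwap hψ
  rwa [neg_neg] at h

/-- Expectations of a spin-swap-invariant matrix are `Γ`-invariant:
`⟨Γψ, H Γψ⟩ = ⟨ψ, H ψ⟩` when `relabel Orb.spinSwap H = H`. [folklore] -/
theorem star_relabelVec_spinSwap_dotProduct_mulVec {H : Matrix (Finset (Orb Λ)) (Finset (Orb Λ)) ℂ}
    (hH : relabel (Orb.spinSwap : Orb Λ ≃ Orb Λ) H = H) (ψ : Fock (Orb Λ)) :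
    star (relabelVec (Orb.spinSwap : Orb Λ ≃ Orb Λ) ψ) ⬝ᵥ
        H *ᵥ relabelVec (Orb.spinSwap : Orb Λ ≃ Orb Λ) ψ = star ψ ⬝ᵥ H *ᵥ ψ := by
  conv_lhs => rw [← hH]
  rw [relabel_mulVec_relabelVec, star_relabelVec_dotProduct]

/-- **Sector energies are even in `S^z`** for a spin-swap-invariant `H`:
`H.minEnergyOn (szSector N (-M)) = H.minEnergyOn (szSector N M)` (`Γ` maps the unit sphere of one
sector onto that of the other, preserving expectations).
[cite: LiebPRL1989, proof of Theorem 1] -/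
theorem minEnergyOn_szSector_neg {H : Matrix (Finset (Orb Λ)) (Finset (Orb Λ)) ℂ}
    (hH : relabel (Orb.spinSwap : Orb Λ ≃ Orb Λ) H = H) (N : ℕ) (M : ℝ) :
    H.minEnergyOn (szSector N (-M)) = H.minEnergyOn (szSector N M) := by
  unfold Matrix.minEnergyOn
  congr 1
  ext E
  constructor
  · rintro ⟨φ, hφ, h1, rfl⟩
    exact ⟨relabelVec Orb.spinSwap φ, mem_szSector_relabelVec_spinSwap_of_neg hφ,
      by rw [star_relabelVec_dotProduct, h1],
      by rw [star_relabelVec_spinSwap_dotProduct_mulVec hH]⟩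
  · rintro ⟨ψ, hψ, h1, rfl⟩
    exact ⟨relabelVec Orb.spinSwap ψ, mem_szSector_neg_relabelVec_spinSwap hψ,
      by rw [star_relabelVec_dotProduct, h1],
      by rw [star_relabelVec_spinSwap_dotProduct_mulVec hH]⟩

/-- **A form bound on the sector `S^z = M` transfers to `S^z = -M`** (spin-swap-invariant `H`):
if `σ ‖φ‖² ≤ Re ⟨φ, H φ⟩` on `szSector N M` then the same holds on `szSector N (-M)`. [folklore] -/
theorem re_rayleigh_ge_szSector_neg {H : Matrix (Finset (Orb Λ)) (Finset (Orb Λ)) ℂ}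
    (hH : relabel (Orb.spinSwap : Orb Λ ≃ Orb Λ) H = H) {N : ℕ} {M σ : ℝ}
    (hσ : ∀ φ ∈ szSector N M, σ * (star φ ⬝ᵥ φ).re ≤ (star φ ⬝ᵥ H *ᵥ φ).re) :
    ∀ φ ∈ szSector N (-M), σ * (star φ ⬝ᵥ φ).re ≤ (star φ ⬝ᵥ H *ᵥ φ).re := by
  intro φ hφ
  have h := hσ _ (mem_szSector_relabelVec_spinSwap_of_neg hφ)
  rwa [star_relabelVec_dotProduct, star_relabelVec_spinSwap_dotProduct_mulVec hH] at h

variable (G : SimpleGraph Λ) [DecidableRel G.Adj]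

/-- **Spin-exchange invariance of the Hubbard Hamiltonian**: `Γ H(t,U) Γ⁻¹ = H(t,U)` (the `μ = 0`
case of the tree's `relabel_spinSwap_hamiltonianWith`; re-homed from a Summits-side theorem file,
see above). [cite: BenfattoGiulianiMastropietro2006, §2.1 (symmetry (1), spin exchange)] -/
theorem relabel_spinSwap_hamiltonian (t U : ℝ) :
    relabel (Orb.spinSwap : Orb Λ ≃ Orb Λ) (hamiltonian G t U) = hamiltonian G t U := by
  rw [← hamiltonianWith_zero G t U, relabel_spinSwap_hamiltonianWith]

/-- **The Hubbard sector energies are even in `S^z`**: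
`λ_min(N, S^z = -M) = λ_min(N, S^z = M)` for all `t`, `U`, `N`, `M` on every finite graph.
[cite: LiebPRL1989, proof of Theorem 1] -/
theorem hubbard_minEnergyOn_szSector_neg (t U : ℝ) (N : ℕ) (M : ℝ) :
    (hamiltonian G t U).minEnergyOn (szSector N (-M)) = (hamiltonian G t U).minEnergyOn (szSector N M) :=
  minEnergyOn_szSector_neg (relabel_spinSwap_hamiltonian G t U) N M

end SpinFlip

/-! ### One-block versions of the spin-gap certificates -/

namespace SpinGapCertificate

variable {Λ : Type*} [LinearOrder Λ] [Fintype Λ] (G : SimpleGraph Λ) [DecidableRel G.Adj]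

/-- **One strict sector inequality suffices** (spin-flip symmetry supplies the other): if
`E₀(2n) < λ_min(2n, S^z = 1)` then the `2n`-particle ground multiplet of the Hubbard Hamiltonian
lies in `szSector (2n) 0`. [folklore] -/
theorem groundSector_le_szSector_of_spinGap_one (t U : ℝ) (n : ℕ)
    (hup : groundEnergyAt G t U (2 * n) < (hamiltonian G t U).minEnergyOn (szSector (2 * n) 1)) :
    (hamiltonian G t U).sectorGroundSpace (nParticleSubmodule (ι := Orb Λ) (2 * n)) ≤
      szSector (2 * n) 0 := by
  refine groundSector_le_szSector_of_spinGap G t U n hup ?_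
  rwa [hubbard_minEnergyOn_szSector_neg G t U (2 * n) 1]

/-- **One form bound suffices**: if `Re ⟨φ, H φ⟩ ≥ σ ‖φ‖²` on the sector `S^z = 1` with
`E₀(2n) < σ`, then the `2n`-particle ground multiplet lies in `szSector (2n) 0`. [folklore] -/
theorem groundSector_le_szSector_of_form_bound (t U : ℝ) (n : ℕ) {σup : ℝ}
    (hup : ∀ φ ∈ szSector (2 * n) 1,
      σup * (star φ ⬝ᵥ φ).re ≤ (star φ ⬝ᵥ hamiltonian G t U *ᵥ φ).re)
    (hσup : groundEnergyAt G t U (2 * n) < σup) :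
    (hamiltonian G t U).sectorGroundSpace (nParticleSubmodule (ι := Orb Λ) (2 * n)) ≤
      szSector (2 * n) 0 :=
  groundSector_le_szSector_of_form_bounds G t U n hup
    (re_rayleigh_ge_szSector_neg (relabel_spinSwap_hamiltonian G t U) hup) hσup hσup

/-- **Sector certificate + ONE spin-gap form bound ⇒ THE ground state** (any finite graph, any
`t`, `U`, `N = 2n ≤ 2|Λ|`): the statement of `SpinGapCertificate.groundState_certificate` with the
form bound required on the sector `S^z = +1` only. [folklore] -/
theorem groundState_certificate_of_form_bound (t U : ℝ) {n : ℕ} (hn : n ≤ Fintype.card Λ)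
    {W : Submodule ℂ (Fock (Orb Λ))} {u : Fock (Orb Λ)} {σ : ℝ}
    (hW : ∀ z ∈ W, σ * (star z ⬝ᵥ z).re ≤ (star z ⬝ᵥ hamiltonian G t U *ᵥ z).re)
    (hWK : ∀ x ∈ szSector (2 * n) 0, ∃ z ∈ W, ∃ c : ℂ, x = z + c • u)
    {w : Fock (Orb Λ)} (hwK : w ∈ szSector (2 * n) 0) (hw1 : star w ⬝ᵥ w = 1)
    {ρ r2 : ℝ} (hρ : (star w ⬝ᵥ hamiltonian G t U *ᵥ w).re = ρ)
    (hr2 : (star (hamiltonian G t U *ᵥ w) ⬝ᵥ hamiltonian G t U *ᵥ w).re ≤ r2 + ρ ^ 2)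
    (hρσ : ρ < σ) {σup : ℝ}
    (hup : ∀ φ ∈ szSector (2 * n) 1, σup * (star φ ⬝ᵥ φ).re ≤ (star φ ⬝ᵥ hamiltonian G t U *ᵥ φ).re)
    (hρup : ρ < σup) :
    ρ - r2 / (σ - ρ) ≤ groundEnergyAt G t U (2 * n) ∧ groundEnergyAt G t U (2 * n) ≤ ρ ∧
      ∃ ψ ∈ szSector (2 * n) 0, star ψ ⬝ᵥ ψ = 1 ∧
        hamiltonian G t U *ᵥ ψ = ((groundEnergyAt G t U (2 * n) : ℝ) : ℂ) • ψ ∧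
        (∀ φ : Fock (Orb Λ), IsNParticle (2 * n) φ →
          hamiltonian G t U *ᵥ φ = ((groundEnergyAt G t U (2 * n) : ℝ) : ℂ) • φ →
            φ = (star ψ ⬝ᵥ φ) • ψ) ∧
        (∀ O : Matrix (Finset (Orb Λ)) (Finset (Orb Λ)) ℂ,
          ((hamiltonian G t U).sectorGroundProj
              (nParticleSubmodule (ι := Orb Λ) (2 * n))).projState O = star ψ ⬝ᵥ O *ᵥ ψ) ∧
        (1 - ‖star ψ ⬝ᵥ w‖ ^ 2) * (σ - ρ) ^ 2 ≤ r2 ∧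
        ∀ {O : Matrix (Finset (Orb Λ)) (Finset (Orb Λ)) ℂ} {m h β : ℝ},
          (∀ x : Fock (Orb Λ), ‖star x ⬝ᵥ O *ᵥ x - (m : ℂ) * (star x ⬝ᵥ x)‖ ≤ h * (star x ⬝ᵥ x).re) →
          0 ≤ β → r2 ≤ β ^ 2 * (σ - ρ) ^ 2 →
          |(((hamiltonian G t U).sectorGroundProj
              (nParticleSubmodule (ι := Orb Λ) (2 * n))).projState O).re -
              (star w ⬝ᵥ O *ᵥ w).re| ≤ 2 * h * (β + β ^ 2) :=
  groundState_certificate G t U hn hW hWK hwK hw1 hρ hr2 hρσ hup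
    (re_rayleigh_ge_szSector_neg (relabel_spinSwap_hamiltonian G t U) hup) hρup hρup

end SpinGapCertificate

end Literature.MathematicalPhysics.QuantumLattice
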